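import Summits.CriticalPhenomena.CardyFormulaZ2.Theorems.CardyWhiteToColouredNoiseDiscretisationStability

/-!
# A countable description of the crossing event of a continuous field

Helper file for item `NoiseDiscretisation` (stmt-CriticalPhenomena-4598) of route
`CardyWhiteToColoured` (`CardyFormulaZ2`). For a conformal rectangle `R` and a *continuous* field
`F`, the crossing event `PosCross[R, F, c]` ("a path in `closure Ω` from `arc 0` to `arc 2` with
`F > c`") is equivalent to a statement about the values of `F` at the countably many medial points
of the lattices `(n+1)⁻¹ ℤ²` (`posCross_iff_countable`): there are a rational `c' > c` and `N` such
that for all `n ≥ N` the configuration of the edges `e` of `ℤ²` with `F(m_{1/(n+1)}(e)) > c'`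
realises Smirnov's crossing event `discreteCrossing Ω (n+1)⁻¹ (arc 0) (arc 2)` — by the two
directions `discreteCrossing_of_posCross` (continuum ⇒ discrete, with the margin
`exists_lt_posCross`) and `posCrossing_of_discreteCrossing` (discrete ⇒ continuum). Consequently
robustness `Robust[R, F]` is such a countable statement too (`robust_iff_countable`), which makes
the no-atom argument of the item a Fubini computation over countably many Gaussian coordinates.

References: V. Beffara, D. Gayet, Publ. IHÉS 126 (2017), §1; S. Smirnov, C. R. Acad. Sci. Paris
333 (2001), §2.
-/

noncomputable section

namespace Summit.CriticalPhenomena.CardyFormulaZ2.Theorems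

namespace WhiteToColoured

open Set Metric MeasureTheory Filter Topology
open Literature.Probability.LatticeModels Literature.Probability.Percolation
open Literature.Probability.RandomPlanarGeometry

/-- `PosCross[R, F, c]`: some path in `closure R.carrier` from `arc 0` to `arc 2` has `F > c`. -/
local notation3 "PosCross[" R ", " F ", " c "]" =>
  ∃ x ∈ MarkedDomain.arc R (0 : Fin 4), ∃ y ∈ MarkedDomain.arc R (2 : Fin 4), ∃ γ : Path x y,
    ∀ t, γ t ∈ closure (JordanDomain.carrier (MarkedDomain.toJordanDomain R)) ∧
      (c : ℝ) < (F : ℂ → ℝ) (γ t)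

/-- `CfgQ[R, F, c]`: the countable form of the crossing event — a rational margin `c' > c` and a
rank `N` such that at every mesh `(n+1)⁻¹`, `n ≥ N`, the edges with `F(medial point) > c'` realise
the discrete crossing event. -/
local notation3 "CfgQ[" R ", " F ", " c "]" =>
  ∃ c' : ℚ, (c : ℝ) < c' ∧ ∃ N : ℕ, ∀ n : ℕ, N ≤ n →
    {e : Sym2 (Site 2) | e ∈ (zdGraph 2).edgeSet ∧
        (c' : ℝ) < (F : ℂ → ℝ) (medialPoint ((n : ℝ) + 1)⁻¹ e)} ∈
      discreteCrossing (JordanDomain.carrier (MarkedDomain.toJordanDomain R)) ((n : ℝ) + 1)⁻¹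
        (MarkedDomain.arc R (0 : Fin 4)) (MarkedDomain.arc R (2 : Fin 4))

/-- Meshes `(n+1)⁻¹` are eventually below any positive threshold. -/
theorem eventually_inv_lt {δ₁ : ℝ} (hδ₁ : 0 < δ₁) : ∃ N : ℕ, ∀ n : ℕ, N ≤ n → ((n : ℝ) + 1)⁻¹ < δ₁ := by
  obtain ⟨N, hN⟩ := exists_nat_gt (1 / δ₁)
  refine ⟨N, fun n hn => ?_⟩
  rw [inv_lt_comm₀ (by positivity) hδ₁]
  have : (N : ℝ) ≤ n := by exact_mod_cast hn
  rw [one_div] at hN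
  linarith

/-- **The crossing event of a continuous field is a countable statement.** -/
theorem posCross_iff_countable (R : ConformalRectangle) {F : ℂ → ℝ} (hF : Continuous F) (c : ℝ) :
    PosCross[R, F, c] ↔ CfgQ[R, F, c] := by
  constructor
  · intro h
    obtain ⟨c'', hc'', h''⟩ := exists_lt_posCross hF h
    obtain ⟨q, hcq, hqc⟩ := exists_rat_btwn hc''
    have hq : PosCross[R, F, q] := posCross_mono hqc.le h''
    obtain ⟨δ₁, hδ₁, hd⟩ := discreteCrossing_of_posCross R hF hq
    obtain ⟨N, hN⟩ := eventually_inv_lt hδ₁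
    refine ⟨q, hcq, N, fun n hn => hd _ (by positivity) (hN n hn) _ fun e he hFe => ⟨he.1, hFe⟩⟩
  · rintro ⟨q, hcq, N, hN⟩
    obtain ⟨δ₁, hδ₁, hd⟩ := posCrossing_of_discreteCrossing R hF hcq
    obtain ⟨N', hN'⟩ := eventually_inv_lt hδ₁
    set n := max N N' with hn
    exact hd _ (by positivity) (hN' n (le_max_right _ _)) _ (fun e he _ => he.2)
      (hN n (le_max_left _ _))

/-- **Robustness of a continuous field is a countable statement.** -/
theorem robust_iff_countable (R : ConformalRectangle) {F : ℂ → ℝ} (hF : Continuous F) :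
    (PosCross[R, F, 0] ∨ ∃ c : ℝ, 0 < c ∧ ¬ PosCross[R, F, -c]) ↔
      (CfgQ[R, F, (0 : ℝ)] ∨ ∃ c : ℚ, 0 < c ∧ ¬ CfgQ[R, F, (-(c : ℝ))]) := by
  rw [posCross_iff_countable R hF 0]
  refine or_congr Iff.rfl ⟨?_, ?_⟩
  · rintro ⟨c, hc, hneg⟩
    obtain ⟨q, hq0, hqc⟩ := exists_rat_btwn hc
    refine ⟨q, by exact_mod_cast hq0, fun hQ => hneg ?_⟩
    rw [← posCross_iff_countable R hF] at hQ
    exact posCross_mono (by linarith) hQ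
  · rintro ⟨q, hq, hneg⟩
    refine ⟨q, by exact_mod_cast hq, fun hP => hneg ?_⟩
    rwa [← posCross_iff_countable R hF]

end WhiteToColoured

end Summit.CriticalPhenomena.CardyFormulaZ2.Theorems
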